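import Literature.Topology.FourManifolds.LefschetzHandlebody
import Summits.SmoothPoincare4.SmoothPoincare4.Theorems.ConvexBisectionAcyclicBisectionExistsKasLoops
import HarnessLib

/-!
# The seam of a multi-attachment of 2-handles: the spaces of Kas' surgery description and the
# open cover `∂X = U ∪ ⋃ᵢ Wᵢ`
(helper for stub `stub_modelsOn_counts` = NF2, clause 3 = Kas' presentation of `H₁(∂X(F; l); ℤ)`;
line `modp-braid-orbits` r9, crux `ConvexBisection.AcyclicBisectionExists`, item
stmt-SmoothPoincare4-10508; wave 4 / W4-D, design lemma (D-cover) `Kas_seamCover` of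
`work/stubs/Kas_Design.lean`, plus §0 of that design: the shared vocabulary of the Kas lemmas
(D), (F), (G).)

* §0 the model spaces of the surgery description (Gompf–Stipsicz §8.2, Kas 1980), continuing
  `…KasLoops.lean` (W4-G: `seamOff h = ∂ Base g ∖ ⋃ Kᵢ`, the Clifford torus `cliffordPt`, the
  longitude/meridian loops and classes `longClass`, `merClass ∈ H₁(seamOff h; ℤ)`): the model
  LONGITUDE `θ ↦ (θ, θ₀)/√2` and MERIDIAN `φ ↦ (θ₀, φ)/√2` in the TUBE SEAM
  `tubeSeam = (T ∖ S) ∩ S³ ≅ T² × ℝ`, and the SPHERE OFF THE CORE `sphereOffCore = S³ ∖ S ≅ D² × S¹`;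
* §1 **`Kas_seamCover`** (= registered sub-goal stub `stub_Kas_seamCover`): for multi-attachment
  data `D` of `X` and a boundary datum `bX`, the seam `bX.carrier ≅ ∂X` is covered by the open sets
  `U = incl⁻¹(range jA) ≃ₜ seamOff h` and `Wᵢ = incl⁻¹(range jBᵢ) ≃ₜ sphereOffCore`, the `Wᵢ`
  pairwise disjoint, the homeomorphisms commuting with `jA`, `jBᵢ` (open smooth embeddings and open
  submanifolds preserve boundary points, `mem_boundary_iff_of_isSmoothEmbedding`,
  `mem_boundary_opens_iff`; `∂𝔻⁴ = S³`, `boundary_closedBall`).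

Everything is proved; no named facts, no `sorry`.  References: R. E. Gompf, A. I. Stipsicz,
*4-Manifolds and Kirby Calculus* (1999), §8.2 [GompfStipsicz1999]; A. Kas, Pacific J. Math. 89
(1980) [Kas1980]; A. A. Kosinski, *Differential Manifolds* (1993), VI §6 [Kosinski1993].
-/

noncomputable section

-- the prescribed namespace `Summit.<P>.<Sub>.…` duplicates `SmoothPoincare4` (P = Sub)
set_option linter.dupNamespace false

open scoped Manifold ContDiff Topology
open Set Function Metric
open Literature.Topology.FourManifolds Literature.Topology.FourManifolds.LefschetzBase
  Literature.AlgebraicTopology.SingularHomology Literature.Topology.FourManifolds.HandleAttachingMap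

namespace Summit.SmoothPoincare4.SmoothPoincare4.Theorems.AcyclicBisectionExists.ModpBraidOrbits

/-! ## §0 The spaces and loops of the surgery description -/

section Spaces

/-- **The tube seam** `(T ∖ S) ∩ S³ = {0 < |x_λ| < 1, ‖x‖ = 1}` — `S³` minus the Hopf link
`S ∪ belt`, `≅ T² × ℝ`; the model of `U ∩ Wᵢ`. [cite: GompfStipsicz1999, §8.2] -/
def tubeSeam : Set ↥(handleTube 3 2) :=
  {y | ‖((y : closedBall (0 : EuclideanSpace ℝ (Fin 4)) 1) : EuclideanSpace ℝ (Fin 4))‖ = 1 ∧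
    lamSq 2 ((y : closedBall (0 : EuclideanSpace ℝ (Fin 4)) 1) : EuclideanSpace ℝ (Fin 4)) ≠ 1}

/-- **The sphere off the core** `S³ ∖ S = {‖x‖ = 1, |x_λ| ≠ 1}` — an open solid torus with core the
belt circle `{x_λ = 0}`; the model of `Wᵢ`. [cite: GompfStipsicz1999, §8.2] -/
def sphereOffCore : Set ↥(beltPiece 3 2) :=
  {b | ‖((b : closedBall (0 : EuclideanSpace ℝ (Fin 4)) 1) : EuclideanSpace ℝ (Fin 4))‖ = 1}

/-- Clifford points lie in the tube seam. [folklore] -/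
theorem cliffordPt_mem_tubeSeam (θ φ : sphere (0 : EuclideanSpace ℝ (Fin 2)) 1) :
    cliffordPt θ φ ∈ tubeSeam :=
  ⟨norm_cliffordVec θ φ, by
    show lamSq 2 (cliffordVec θ φ) ≠ 1
    rw [lamSq_cliffordVec]; norm_num⟩

/-- The model longitude `θ ↦ (θ, θ₀)/√2` in the tube seam. [cite: GompfStipsicz1999, §8.2] -/
def modelLong : sphere (0 : EuclideanSpace ℝ (Fin 2)) 1 → ↥tubeSeam :=
  fun θ => ⟨cliffordPt θ baseAngle, cliffordPt_mem_tubeSeam θ baseAngle⟩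

/-- The model meridian `φ ↦ (θ₀, φ)/√2` in the tube seam. [cite: GompfStipsicz1999, §8.2] -/
def modelMer : sphere (0 : EuclideanSpace ℝ (Fin 2)) 1 → ↥tubeSeam :=
  fun φ => ⟨cliffordPt baseAngle φ, cliffordPt_mem_tubeSeam baseAngle φ⟩

/-- The model longitude is continuous. [folklore] -/
theorem continuous_modelLong : Continuous modelLong :=
  Continuous.subtype_mk (continuous_cliffordPt.comp (continuous_id.prodMk continuous_const)) _

/-- The model meridian is continuous. [folklore] -/
theorem continuous_modelMer : Continuous modelMer :=
  Continuous.subtype_mk (continuous_cliffordPt.comp (continuous_const.prodMk continuous_id)) _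

/-- The tube seam, read in the belt piece `𝔻⁴ ∖ S` (same points: `|x_λ| ≠ 1`), lies in the sphere
off the core. [cite: GompfStipsicz1999, §8.2] -/
def tubeSeamToSphereOffCore : ↥tubeSeam → ↥sphereOffCore :=
  fun y => ⟨⟨((y : ↥(handleTube 3 2)) : closedBall (0 : EuclideanSpace ℝ (Fin 4)) 1), by
    rw [mem_beltPiece]; exact y.2.2⟩, y.2.1⟩

/-- The inclusion of the tube seam in the sphere off the core is continuous. [folklore] -/
theorem continuous_tubeSeamToSphereOffCore : Continuous tubeSeamToSphereOffCore :=
  Continuous.subtype_mk (Continuous.subtype_mk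
    (continuous_subtype_val.comp continuous_subtype_val) _) _

/-- The continuous inclusion of the tube seam in the sphere off the core. [folklore] -/
abbrev toSphereC : C(↥tubeSeam, ↥sphereOffCore) :=
  ⟨tubeSeamToSphereOffCore, continuous_tubeSeamToSphereOffCore⟩

end Spaces

/-! ## §1 The open cover of the seam of a multi-attachment -/

section Cover

/-- **An embedding identifies `f ⁻¹' S` with `range f ∩ S`.** [folklore] -/
def preimageHomeomorphRangeInter {Y Z : Type*} [TopologicalSpace Y] [TopologicalSpace Z]
    {f : Y → Z} (hf : Topology.IsEmbedding f) (S : Set Z) : ↥(f ⁻¹' S) ≃ₜ ↥(range f ∩ S) where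
  toFun y := ⟨f y, mem_range_self _, y.2⟩
  invFun z := ⟨hf.toHomeomorph.symm ⟨z, z.2.1⟩, by
    show f (hf.toHomeomorph.symm ⟨z, z.2.1⟩) ∈ S
    rw [← hf.toHomeomorph_apply_coe, Homeomorph.apply_symm_apply]
    exact z.2.2⟩
  left_inv y := by
    apply Subtype.ext
    show hf.toHomeomorph.symm ⟨f y, _⟩ = y.1
    rw [Homeomorph.symm_apply_eq]
    exact Subtype.ext (hf.toHomeomorph_apply_coe _).symm
  right_inv z := by
    apply Subtype.ext
    show f (hf.toHomeomorph.symm ⟨z, z.2.1⟩) = z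
    rw [← hf.toHomeomorph_apply_coe, Homeomorph.apply_symm_apply]
  continuous_toFun := (hf.continuous.comp continuous_subtype_val).subtype_mk _
  continuous_invFun :=
    (hf.toHomeomorph.symm.continuous.comp (continuous_subtype_val.subtype_mk fun z => z.2.1)).subtype_mk _

/-- The homeomorphism `preimageHomeomorphRangeInter` is `f` on points. [folklore] -/
@[simp] theorem preimageHomeomorphRangeInter_apply_coe {Y Z : Type*} [TopologicalSpace Y]
    [TopologicalSpace Z] {f : Y → Z} (hf : Topology.IsEmbedding f) (S : Set Z) (y : ↥(f ⁻¹' S)) :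
    (preimageHomeomorphRangeInter hf S y : Z) = f y := rfl

/-- `f` of the inverse of `preimageHomeomorphRangeInter` is the point. [folklore] -/
theorem apply_preimageHomeomorphRangeInter_symm {Y Z : Type*} [TopologicalSpace Y]
    [TopologicalSpace Z] {f : Y → Z} (hf : Topology.IsEmbedding f) (S : Set Z)
    (z : ↥(range f ∩ S)) : f ((preimageHomeomorphRangeInter hf S).symm z) = z := by
  have h := (preimageHomeomorphRangeInter hf S).apply_symm_apply z
  exact congrArg Subtype.val h

/-- **Two embeddings identify the mutual preimages of their ranges**, compatibly: `e y` is the point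
of `j ⁻¹' (range f)` with `j (e y) = f y`. [folklore] -/
theorem exists_homeomorph_preimage_preimage {Y Z P : Type*} [TopologicalSpace Y]
    [TopologicalSpace Z] [TopologicalSpace P] {f : Y → Z} (hf : Topology.IsEmbedding f) {j : P → Z}
    (hj : Topology.IsEmbedding j) :
    ∃ e : ↥(f ⁻¹' range j) ≃ₜ ↥(j ⁻¹' range f), ∀ y, j (e y) = f y := by
  refine ⟨(preimageHomeomorphRangeInter hf (range j)).trans ((Homeomorph.setCongr
    (inter_comm _ _)).trans (preimageHomeomorphRangeInter hj (range f)).symm), fun y => ?_⟩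
  rw [Homeomorph.trans_apply, Homeomorph.trans_apply]
  exact apply_preimageHomeomorphRangeInter_symm hj (range f) _

variable {g : ℕ} {l : List ((Fin g ⊕ Fin g → ℤ) × Bool)}
  {h : Fin l.length → HandleAttachingMap 3 2 (Base g)}
  {X : Type} [TopologicalSpace X] [ChartedSpace (EuclideanHalfSpace 4) X]

/-- **The part of `V ∖ ⋃ cores` sent by `jA` into the seam `∂X` is the seam off the cores**
(open smooth embeddings and open submanifolds preserve boundary points). [cite: Kosinski1993, VI §6] -/
theorem preimage_jA_boundary_eq (D : MultiAttachmentData h (𝓡∂ 4) X) :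
    (D.jA ⁻¹' (𝓡∂ 4).boundary X) = Subtype.val ⁻¹' (𝓡∂ 4).boundary (Base g) := by
  ext a
  rw [mem_preimage, mem_boundary_iff_of_isSmoothEmbedding D.hjA D.hjAo, mem_preimage]
  exact mem_boundary_opens_iff (coresComplement h) a

/-- **The part of `𝔻⁴ ∖ S` sent by `jBᵢ` into the seam `∂X` is the sphere off the core**
(`∂𝔻⁴ = S³`). [cite: Kosinski1993, VI §6] -/
theorem preimage_jB_boundary_eq (D : MultiAttachmentData h (𝓡∂ 4) X) (i : Fin l.length) :
    (D.jB i ⁻¹' (𝓡∂ 4).boundary X) = sphereOffCore := by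
  ext b
  rw [mem_preimage, mem_boundary_iff_of_isSmoothEmbedding (D.hjB i).1 (D.hjB i).2,
    mem_boundary_opens_iff (beltPiece 3 2) b]
  change (b : closedBall (0 : EuclideanSpace ℝ (Fin 4)) 1) ∈ (𝓡∂ (3 + 1)).boundary
    (closedBall (0 : EuclideanSpace ℝ (Fin (3 + 1))) 1) ↔ _
  rw [boundary_closedBall]
  rfl

/-- **(D-cover) `Kas_seamCover`** (= registered sub-goal stub `stub_Kas_seamCover` of
`stub_modelsOn_counts`).  The seam `bX.carrier ≅ ∂X` of a multi-attachment is covered by the open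
sets `U = incl⁻¹(range jA)` and `Wᵢ = incl⁻¹(range jBᵢ)`, the `Wᵢ` pairwise disjoint, with
`U ≃ₜ seamOff h` (through `jA`) and `Wᵢ ≃ₜ sphereOffCore` (through `jBᵢ`), compatibly with `jA`,
`jBᵢ`. [cite: GompfStipsicz1999, §8.2] -/
theorem Kas_seamCover (D : MultiAttachmentData h (𝓡∂ 4) X) (bX : BoundaryData (𝓡∂ 4) X (𝓡 3)) :
    IsOpen (bX.incl ⁻¹' range D.jA) ∧ (∀ i, IsOpen (bX.incl ⁻¹' range (D.jB i))) ∧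
    (bX.incl ⁻¹' range D.jA) ∪ (⋃ i, bX.incl ⁻¹' range (D.jB i)) = univ ∧
    (Pairwise fun i j => Disjoint (bX.incl ⁻¹' range (D.jB i)) (bX.incl ⁻¹' range (D.jB j))) ∧
    (∃ eU : ↥(bX.incl ⁻¹' range D.jA) ≃ₜ ↥(seamOff h),
      ∀ y, D.jA ⟨(eU y : Base g), (eU y).2.2⟩ = bX.incl y) ∧
    (∀ i, ∃ eW : ↥(bX.incl ⁻¹' range (D.jB i)) ≃ₜ ↥sphereOffCore,
      ∀ y, D.jB i ((eW y : ↥sphereOffCore) : ↥(beltPiece 3 2)) = bX.incl y) := by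
  have hincl := bX.isSmoothEmbedding.isEmbedding
  refine ⟨D.hjAo.preimage bX.continuous_incl, fun i => (D.hjB i).2.preimage bX.continuous_incl,
    ?_, ?_, ?_, fun i => ?_⟩
  · rw [← preimage_iUnion, ← preimage_union, D.cover, preimage_univ]
  · exact fun i j hij => (D.disjointB hij).preimage bX.incl
  · obtain ⟨e, he⟩ := exists_homeomorph_preimage_preimage hincl D.hjA.isEmbedding
    have hset : (D.jA ⁻¹' range bX.incl) = Subtype.val ⁻¹' (𝓡∂ 4).boundary (Base g) := by
      rw [bX.range_incl, preimage_jA_boundary_eq D]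
    refine ⟨e.trans ((Homeomorph.setCongr hset).trans ((preimageValHomeomorph _ _).trans
      (Homeomorph.setCongr (inter_comm _ _)))), fun y => ?_⟩
    rw [← he y]
    rfl
  · obtain ⟨e, he⟩ := exists_homeomorph_preimage_preimage hincl (D.hjB i).1.isEmbedding
    have hset : (D.jB i ⁻¹' range bX.incl) = sphereOffCore := by
      rw [bX.range_incl, preimage_jB_boundary_eq D i]
    exact ⟨e.trans (Homeomorph.setCongr hset), fun y => he y⟩

end Cover

/-! ## §2 The registered sub-goal stub -/

/-- **(D-cover) registered sub-goal stub `stub_Kas_seamCover`** of `stub_modelsOn_counts` (design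
lemma `Kas_seamCover`, feeder of (D) `Kas_seam_quotient`): the open cover `∂X = U ∪ ⋃ Wᵢ` of the seam
of a multi-attachment of 2-handles on `Base g`, `U ≃ₜ seamOff h`, `Wᵢ ≃ₜ sphereOffCore`.
[cite: GompfStipsicz1999, §8.2] -/
theorem stub_Kas_seamCover : ∀ (g : ℕ) (l : List ((Fin g ⊕ Fin g → ℤ) × Bool))
    (h : Fin l.length → Literature.Topology.FourManifolds.HandleAttachingMap 3 2
      (Literature.Topology.FourManifolds.LefschetzBase.Base g))
    (X : Type) [TopologicalSpace X] [T2Space X] [SecondCountableTopology X] [CompactSpace X]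
    [ChartedSpace (EuclideanHalfSpace 4) X] [IsManifold (𝓡∂ 4) ∞ X]
    (D : Literature.Topology.FourManifolds.HandleAttachingMap.MultiAttachmentData h (𝓡∂ 4) X)
    (bX : Literature.Topology.FourManifolds.BoundaryData (𝓡∂ 4) X (𝓡 3)),
    IsOpen (bX.incl ⁻¹' Set.range D.jA) ∧ (∀ i, IsOpen (bX.incl ⁻¹' Set.range (D.jB i))) ∧
    (bX.incl ⁻¹' Set.range D.jA) ∪ (⋃ i, bX.incl ⁻¹' Set.range (D.jB i)) = Set.univ ∧
    (Pairwise fun i j => Disjoint (bX.incl ⁻¹' Set.range (D.jB i)) (bX.incl ⁻¹' Set.range (D.jB j))) ∧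
    (∃ eU : ↥(bX.incl ⁻¹' Set.range D.jA) ≃ₜ ↥(seamOff h),
      ∀ y, D.jA ⟨(eU y : Literature.Topology.FourManifolds.LefschetzBase.Base g), (eU y).2.2⟩ =
        bX.incl y) ∧
    (∀ i, ∃ eW : ↥(bX.incl ⁻¹' Set.range (D.jB i)) ≃ₜ ↥sphereOffCore,
      ∀ y, D.jB i ((eW y : ↥sphereOffCore) : ↥(Literature.Topology.FourManifolds.beltPiece 3 2)) =
        bX.incl y) :=
  fun _ _ _ _ _ _ _ _ _ _ D bX => Kas_seamCover D bX

end Summit.SmoothPoincare4.SmoothPoincare4.Theorems.AcyclicBisectionExists.ModpBraidOrbits
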